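import Summits.QuantumFields.YangMills.Theorems.UnitScaleTiltProp7EMLTowerCentral
import HarnessLib

/-!
# Route `UnitScaleTilt`, crux K1 child «MinimiserStabilityRegPr» (stmt-QuantumFields-19200), stub `stub_existenceMinimalOrbit` (EX), the J-term rows of the EX knit —
# **CENTRE-EQUIVARIANCE OF THE COVARIANT EXP-MEAN-LOG TOWER AT A GENERAL PERTURBED FIELD**: `dbarCovIterU k U₀ ((ιφ)·W) = (ι ∘ U̿^{(k)}(φ)) · dbarCovIterU k U₀ W` for ANY
# `W` (✓`…EMLTowerCentral` is the case `W = U₀`), under the displayed `1∕8`-smallness of the (0.4) loop variables of the `W`-tower and of the scalar tower AND of the twisted stair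
# transporters of the `W`-tower against the background tower (these are `1` at `W = U₀`).  The input of (Q-b)⁽²⁾ (ym-inputs-p01 g2 12:05:39Z: the central directions of print's
# `C⁽²⁾(U₀) = ½·D²(log U̿^{twS})(0)` vanish — additivity of the twisted log-chart in central directions, T³ sibling `…QTwSCentralAdditive`).

Cell `ym3-torus`, width seat `ym-ust-20520-w5` (gen 5).  `--supports stmt-QuantumFields-19200 --as helper`; THEOREMS ONLY (0 `def`, 0 `sorry`); count-neutral; nothing here claims
the stub, the crux, d = 4 or the mass gap — YM₃ on T³ is a ladder rung (R3), not the Clay problem.  Generic: any complete normed `ℂ`-algebra `𝔸` with `‖1‖ = 1`, any `Params`.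

WHAT IS PROVED (`ι := algebraMap ℂ 𝔸`, `ιˣ := Units.map ι`, `(ιφ)·W := fun b => ιˣ (φ b) * W b`).
* §1 `tstairU_centralMul` — `tstairU U₀ ((ιφ)·W) y i = ιˣ (φ(stairᵢ)) · tstairU U₀ W y i` (EXACT: ✓`holT_centralMul`); `vframeCovU_centralMul` — `w((ιφ)·W)(y) = ιˣ (vframeU φ y) · w(W)(y)`
  when the twisted stairs of `W` and the stairs of `φ` at `y` are within `1∕8` of `1` (✓`eml_algebraMap_mul`); `dbarCovU_centralMul` — `dbarCovU U₀ ((ιφ)·W) c = ιˣ (dbarAvgU φ c) · dbarCovU U₀ W c`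
  (loops of `W`, `φ` at `c` and twisted∕scalar stairs at both ends within `1∕8`; the central factors commute past every unit).
* §2 ★★`dbarCovIterU_centralMul` — the tower: `dbarCovIterU k U₀ ((ιφ)·W) = fun e => ιˣ (dbarIterU k φ e) * dbarCovIterU k U₀ W e` under the four level-wise displayed rows
  (loops of `dbarCovIterU j U₀ W` and of `dbarIterU j φ`, twisted stairs `tstairU (emlIterU j U₀) (dbarCovIterU j U₀ W)`, stairs of `dbarIterU j φ`; all `j < k`, all `≤ 1∕8`).
HONEST SCOPE.  Algebra of the printed operations plus the `1∕8`-window of ✓`mlog_algebraMap_mul`; nothing of [Balaban1985Averaging] is asserted; the smallness rows are displayed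
(their T³ suppliers at `U₀ ∈ 𝔘_k(ε₀)`, `W = e^{A}U₀♭` in the ball: ★w4-20520 g3's ✓`norm_dbarCovIterU_rel_frameAccU_le_of_plaqSmall` lineage).

References: T. Bałaban, CMP **98** (1985) 17–51 [Balaban1985Averaging] ((8)–(9) p.19, (21) p.22, (58) p.27, (82) p.30, (89)–(92) p.31, (97) p.32, (127) p.36); CMP **109** (1987) 249–301
[Balaban1987RG1] ((0.4), (0.6) p.253).
-/

set_option autoImplicit false

noncomputable section

open scoped Matrix.Norms.L2Operator

namespace Summit.QuantumFields.YangMills.Theorems.Prop7SymAvgTwSym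

open NormedSpace
open Literature.MathematicalPhysics.QuantumFieldTheory.Balaban1983to89
open T4Continuum BlockAveraging ExpMeanLog MatrixLog
open B10Eq27TorusAxialLog (holT gaugeActT gaugeActT_apply)
open Summit.QuantumFields.YangMills.Theorems.Prop8Chart (loopHolU emlAvgU coe_emlAvgU emlIterU emlIterU_succ emlIterU_zero)
open Summit.QuantumFields.YangMills.Theorems.Prop8ChartDoubleBar (vframeU coe_vframeU dbarAvgU dbarAvgU_apply dbarIterU dbarIterU_succ dbarIterU_zero)

variable {𝔸 : Type*} [NormedRing 𝔸] [NormOneClass 𝔸] [NormedAlgebra ℂ 𝔸] [CompleteSpace 𝔸]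

/-! ## §1 One level at a general perturbed field -/

section OneLevel

variable {P : Params} {j : ℕ}

omit [NormOneClass 𝔸] [CompleteSpace 𝔸] in
/-- a central unit as a scalar multiple of `1`: `↑(ιˣ z) = (z : ℂ) • 1`. [folklore] -/
theorem coe_unitsMap_algebraMap (z : ℂˣ) :
    ((Units.map ((algebraMap ℂ 𝔸 : ℂ →+* 𝔸) : ℂ →* 𝔸) z : 𝔸ˣ) : 𝔸) = (z : ℂ) • (1 : 𝔸) := by
  rw [Units.coe_map, MonoidHom.coe_coe, Algebra.algebraMap_eq_smul_one]

omit [NormOneClass 𝔸] [CompleteSpace 𝔸] in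
/-- **THE TWISTED STAIR TRANSPORTERS (58) OF `(ιφ)·W` AGAINST `U₀`**: `((ιφ)W)(Γ)·U₀(Γ)⁻¹ = ι(φ(Γ)) · (W(Γ)·U₀(Γ)⁻¹)` — exact. [cite: Balaban1985Averaging, (58) p.27, (9) p.19] -/
theorem tstairU_centralMul (φ : GaugeField P j ℂˣ) (U₀ W : GaugeField P j 𝔸ˣ) (y : Site P (j + 1)) (i : Idx P) :
    tstairU U₀ (fun b => Units.map ((algebraMap ℂ 𝔸 : ℂ →+* 𝔸) : ℂ →* 𝔸) (φ b) * W b) y i =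
      Units.map ((algebraMap ℂ 𝔸 : ℂ →+* 𝔸) : ℂ →* 𝔸) (holT φ (emb y) (stairWord i.2.1 (off i.1))) * tstairU U₀ W y i := by
  rw [tstairU_def, tstairU_def, holT_centralMul, mul_assoc]

/-- **THE COVARIANT FRAME (82) OF `(ιφ)·W` AGAINST `U₀`**: `w((ιφ)·W)(y) = ι(vframeU φ y) · w(W)(y)` when the twisted stairs of `W` and the stairs of `φ` at `y` are within `1∕8`
of `1`. [cite: Balaban1985Averaging, (82) p.30, (21) p.22] -/
theorem vframeCovU_centralMul (φ : GaugeField P j ℂˣ) (U₀ W : GaugeField P j 𝔸ˣ) (y : Site P (j + 1))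
    (hT : ∀ i : Idx P, ‖((tstairU U₀ W y i : 𝔸ˣ) : 𝔸) - 1‖ ≤ 1 / 8)
    (hφ : ∀ i : Idx P, ‖((holT φ (emb y) (stairWord i.2.1 (off i.1)) : ℂˣ) : ℂ) - 1‖ ≤ 1 / 8) :
    vframeCovU U₀ (fun b => Units.map ((algebraMap ℂ 𝔸 : ℂ →+* 𝔸) : ℂ →* 𝔸) (φ b) * W b) y =
      Units.map ((algebraMap ℂ 𝔸 : ℂ →+* 𝔸) : ℂ →* 𝔸) (vframeU φ y) * vframeCovU U₀ W y := by
  apply Units.ext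
  rw [coe_vframeCovU, Units.val_mul, Units.coe_map, MonoidHom.coe_coe, coe_vframeU, coe_vframeCovU]
  have hfam : (fun i : Idx P => ((tstairU U₀ (fun b => Units.map ((algebraMap ℂ 𝔸 : ℂ →+* 𝔸) : ℂ →* 𝔸) (φ b) * W b) y i : 𝔸ˣ) : 𝔸)) =
      fun i : Idx P => algebraMap ℂ 𝔸 ((holT φ (emb y) (stairWord i.2.1 (off i.1)) : ℂˣ) : ℂ) * ((tstairU U₀ W y i : 𝔸ˣ) : 𝔸) := by
    funext i
    rw [tstairU_centralMul, Units.val_mul, Units.coe_map]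
    rfl
  rw [hfam, eml_algebraMap_mul hφ hT]

/-- **THE COVARIANT DOUBLE BAR (89) OF `(ιφ)·W` AGAINST `U₀`**: `dbarCovU U₀ ((ιφ)·W)(c) = ι(U̿(φ)(c)) · dbarCovU U₀ W c` — loops of `W` and `φ` at `c`, twisted stairs of `W` and stairs
of `φ` at both ends of `c`, all within `1∕8` of `1`; the central factors commute past every unit. [cite: Balaban1985Averaging, (89) p.31, (8)-(9) p.19] -/
theorem dbarCovU_centralMul (φ : GaugeField P j ℂˣ) (U₀ W : GaugeField P j 𝔸ˣ) (c : PBond P (j + 1))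
    (hW : ∀ i : Idx P, ‖((loopHolU W c i : 𝔸ˣ) : 𝔸) - 1‖ ≤ 1 / 8) (hφ : ∀ i : Idx P, ‖((loopHolU φ c i : ℂˣ) : ℂ) - 1‖ ≤ 1 / 8)
    (hTs : ∀ i : Idx P, ‖((tstairU U₀ W c.src i : 𝔸ˣ) : 𝔸) - 1‖ ≤ 1 / 8) (hTt : ∀ i : Idx P, ‖((tstairU U₀ W c.tgt i : 𝔸ˣ) : 𝔸) - 1‖ ≤ 1 / 8)
    (hφs : ∀ i : Idx P, ‖((holT φ (emb c.src) (stairWord i.2.1 (off i.1)) : ℂˣ) : ℂ) - 1‖ ≤ 1 / 8)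
    (hφt : ∀ i : Idx P, ‖((holT φ (emb c.tgt) (stairWord i.2.1 (off i.1)) : ℂˣ) : ℂ) - 1‖ ≤ 1 / 8) :
    dbarCovU U₀ (fun b => Units.map ((algebraMap ℂ 𝔸 : ℂ →+* 𝔸) : ℂ →* 𝔸) (φ b) * W b) c =
      Units.map ((algebraMap ℂ 𝔸 : ℂ →+* 𝔸) : ℂ →* 𝔸) (dbarAvgU φ c) * dbarCovU U₀ W c := by
  rw [dbarCovU_apply, vframeCovU_centralMul φ U₀ W c.src hTs hφs, vframeCovU_centralMul φ U₀ W c.tgt hTt hφt, emlAvgU_centralMul φ W c hW hφ,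
    dbarCovU_apply, dbarAvgU_apply, map_mul, map_mul, map_inv, mul_inv_rev, ← map_inv]
  apply Units.ext
  simp only [Units.val_mul, coe_unitsMap_algebraMap, smul_mul_assoc, mul_smul_comm, one_mul, mul_one, smul_smul]

end OneLevel

/-! ## §2 The tower at a general perturbed field -/

section Tower

variable {P : Params}

/-- ★★ **THE COVARIANT TOWER OF `(ιφ)·W` AGAINST `U₀` FACTORS THROUGH THE SCALAR TOWER**: `dbarCovIterU k U₀ ((ιφ)·W) = (ι ∘ U̿^{(k)}(φ)) · dbarCovIterU k U₀ W` PROVIDED, at every level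
`j < k`, the (0.4) loop variables of `dbarCovIterU j U₀ W` and of `U̿^{(j)}(φ)`, the twisted stair transporters of `dbarCovIterU j U₀ W` against `Ū₀ʲ`, and the stairs of `U̿^{(j)}(φ)` are
within `1∕8` of `1` — displayed (their suppliers at a printed-regular `U₀` and `W = e^{A}U₀♭` in the ball are the T³ siblings). [cite: Balaban1985Averaging, (92) p.31, (97) p.32, (127) p.36] -/
theorem dbarCovIterU_centralMul (φ : GaugeField P 0 ℂˣ) (U₀ W : GaugeField P 0 𝔸ˣ) :
    ∀ k : ℕ,
      (∀ j, j < k → ∀ (c : PBond P (j + 1)) (i : Idx P), ‖((loopHolU (dbarCovIterU j U₀ W) c i : 𝔸ˣ) : 𝔸) - 1‖ ≤ 1 / 8) →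
      (∀ j, j < k → ∀ (c : PBond P (j + 1)) (i : Idx P), ‖((loopHolU (dbarIterU j φ) c i : ℂˣ) : ℂ) - 1‖ ≤ 1 / 8) →
      (∀ j, j < k → ∀ (y : Site P (j + 1)) (i : Idx P), ‖((tstairU (emlIterU j U₀) (dbarCovIterU j U₀ W) y i : 𝔸ˣ) : 𝔸) - 1‖ ≤ 1 / 8) →
      (∀ j, j < k → ∀ (y : Site P (j + 1)) (i : Idx P), ‖((holT (dbarIterU j φ) (emb y) (stairWord i.2.1 (off i.1)) : ℂˣ) : ℂ) - 1‖ ≤ 1 / 8) →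
      dbarCovIterU k U₀ (fun b => Units.map ((algebraMap ℂ 𝔸 : ℂ →+* 𝔸) : ℂ →* 𝔸) (φ b) * W b) =
        fun e => Units.map ((algebraMap ℂ 𝔸 : ℂ →+* 𝔸) : ℂ →* 𝔸) (dbarIterU k φ e) * dbarCovIterU k U₀ W e
  | 0 => fun _ _ _ _ => by
    funext e
    rw [dbarCovIterU_zero, dbarIterU_zero, dbarCovIterU_zero]
  | k + 1 => fun hW hφ hT hφs => by
    have hk := dbarCovIterU_centralMul φ U₀ W k (fun j hj => hW j (by omega)) (fun j hj => hφ j (by omega)) (fun j hj => hT j (by omega))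
      (fun j hj => hφs j (by omega))
    funext e
    rw [dbarCovIterU_succ, hk, dbarIterU_succ, dbarCovIterU_succ]
    exact dbarCovU_centralMul (dbarIterU k φ) (emlIterU k U₀) (dbarCovIterU k U₀ W) e (hW k (by omega) e) (hφ k (by omega) e)
      (hT k (by omega) e.src) (hT k (by omega) e.tgt) (hφs k (by omega) e.src) (hφs k (by omega) e.tgt)

end Tower

end Summit.QuantumFields.YangMills.Theorems.Prop7SymAvgTwSym

end
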